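import Summits.QuantumFields.YangMills.Theorems.BalabanUVNodesK2Line1PrimeRemainderPrice

/-!
# K2⁷ `EndpointGivenBR13SepCoPH` — NEGATIVE LEMMA on LINE 2's stub S2 «per-scale anchor of the record's definitional split»
  (skeleton v3 `stub_anchor13 : D4AnchorRecord13`): FALSE MODULO two base histories

Cell ym-nodeO-ideate, seat CRIT-2 g2 (critic re-price; sheet `Cruxes/EndpointGivenBR13SepCoPH/CRIT-2-REPRICE-v3.md` §2 P2★, probe `Crit2RepriceV3Probe.lean`).

The registered stub (v3 `D80-K2V3/K2Skeleton13SepCoPHv3.lean` :417, with the skeleton-local abbreviation `AnchorVanishing` :233 unfolded; text spelled INLINE below)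
  S2  `∀ F θ (hP : θ.Provisos₁₃SepCoPH F 2), θ.Admissible F 2 → ∀ k δ, 0 < δ → ∃ γ > 0, ∀ v ∈ Box γ k, |β¹_k(v)| ≤ δ`
for the record's DEFINITIONAL split `oneLoopSplit_betaOfMerged βm (beta0OfMerged βm θ.v₀) θ.γ` is false as soon as ONE family carries two proviso-carrying admissible
Stage-13 tuples whose β-functions of record AGREE on a common box `]0,γ₁]` but DIFFER at the zero history at some scale (hypothesis spelled inline; NOT constructed
here — it needs K0⁷-type inhabitation and the values of two `limUnder`s).  Why that is the situation the stub quantifies over: the β of record is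
`betaOfMerged βm β⁰ γ` — EQUAL to the merged β `βm` ON the box and to the one-loop number `β⁰ := beta0OfMerged βm θ.v₀` OFF it (`Node00/BetaOfRecord.lean` :198–:210),
`β⁰_k` being the one-sided `limUnder` of `βm` along the LAST-coupling path through the BASE HISTORY `θ.v₀ k` (:192); `v₀` is the free last field of `Stage8Params`
(`Node00/Record8.lean` :51) read by NO admissibility clause of Stages 8–13 (:59; Record9 :116; Record11 :281; Record12 :269–:275; Record13 :133) and by no proviso,
while `βm` and the box do not read `v₀` at all — so two tuples differing only in `v₀` have the SAME β on the box and one-loop numbers read along two DIFFERENT paths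
(the records of record take `v₀ := 0`: the path `(0,…,0,g)` runs along the zero edge, outside every box).  Mechanism (§1): a vanishing split remainder anchors β at
its zero-history values scale by scale; anchors transfer along agreement on a box; two anchors of one β have the same numbers (an4 `eq_of_anchors`).  So S2 as
typed asserts, beyond [I] (2.13) «vanishes at g_k = 0» (stated on the domain (1.2)∕(0.21)), the BASE-HISTORY-INDEPENDENCE of the record's `limUnder` numbers across
all proviso-carrying admissible tuples sharing a merged β.  The repair (sheet §2): reference line 2 to NAMED numbers (`beta0OfJs F κ`, θ-covariant per CRIT-1 g2) with
the line's lemmas re-typed split-free.  Edition 2 (§2, appended): the generic per-record kill `anchorAtZero13_false_of_twoBaseHistories` (any per-tuple anchor of the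
β of record at its zero-history values) and its instance `af1AtRecord13_false_of_twoBaseHistories` (idea-5's (AF-1) currency as typed relative to the DEFINITIONAL split,
sketch `ConvexFibreWittenSketch.lean` :97 — equally exposed; re-keyed to named numbers it is not).  Nothing of Bałaban's is asserted; K2⁷ stays OPEN; the Clay YM mass gap is NOT proved by any of this (R4 = the conditional
finite-𝕋⁴ rung `BalabanLadder.UV` only).
-/

noncomputable section

open scoped Matrix.Norms.L2Operator

namespace Summit.QuantumFields.YangMills.Theorems.EndpointGivenBR13SepCoPH.Negative.Anchor13FalseOfTwoBaseHistories

open Literature.MathematicalPhysics.QuantumFieldTheory.Balaban1983to89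
open Literature.MathematicalPhysics.QuantumFieldTheory.Balaban1983to89.FlowStep
open Literature.MathematicalPhysics.QuantumFieldTheory.Balaban1983to89.T4Continuum (T4Family)
open Literature.MathematicalPhysics.QuantumFieldTheory.Balaban1983to89.B12Beta (HistBox OneLoopSplit)
open Literature.MathematicalPhysics.QuantumFieldTheory.Balaban1983to89.Node00
open Summit.QuantumFields.YangMills.Theorems.BalabanUVNodesK2JsOfRecord (BoxRemainder)
open Summit.QuantumFields.YangMills.Theorems.BalabanUVNodesK2Line1PrimeRemainderPrice (eq_of_anchors anchor_of_boxRemainder)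

/-! ## §1 Generic: a vanishing split remainder anchors `β` at its zero-history values; anchors transfer along agreement on a box -/

section Generic

variable {β β' : HBeta} {b : ℕ → ℝ}

/-- the remainder of a one-loop split IS `β − β⁰`. [folklore] -/
theorem split_β1_eq (S : OneLoopSplit β) (k : ℕ) (p : Fin (k + 1) → ℝ) : S.β1 k p = β k p - S.β0 k := by
  rw [S.split k p]; ring

/-- the one-loop numbers of a split ARE the values of `β` at the zero history (`split` ∕ `vanish` there). [folklore] -/
theorem split_β0_eq_apply_zero (S : OneLoopSplit β) (k : ℕ) : S.β0 k = β k (fun _ => 0) := by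
  have h := S.split k (fun _ => 0)
  rw [S.vanish k _ rfl, add_zero] at h
  exact h.symm

/-- per-scale vanishing of a split's remainder near the zero history ⟹ a per-scale ANCHOR of `β` at its zero-history values (an4's anchor shape). [folklore] -/
theorem anchorAtZero_of_anchorVanishing (S : OneLoopSplit β)
    (h : ∀ k : ℕ, ∀ δ : ℝ, 0 < δ → ∃ γ : ℝ, 0 < γ ∧ ∀ v ∈ Box γ k, |S.β1 k v| ≤ δ) :
    ∀ (k : ℕ) (δ : ℝ), 0 < δ → ∃ γ : ℝ, 0 < γ ∧ ∀ p : Fin (k + 1) → ℝ, p ∈ HistBox γ k → |β k p - β k (fun _ => 0)| ≤ δ := by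
  intro k δ hδ
  obtain ⟨γ, hγ, hb⟩ := h k δ hδ
  refine ⟨γ, hγ, fun p hp => ?_⟩
  rw [← split_β0_eq_apply_zero S k, ← split_β1_eq S]
  exact hb p (by rwa [histBox_eq_box] at hp)

/-- anchors transfer along agreement of two β's on a box `]0,γ₁]` (shrink to the common box). [folklore] -/
theorem anchor_congr_of_eqOn {γ₁ : ℝ} (hγ₁ : 0 < γ₁)
    (hagree : ∀ (k : ℕ) (p : Fin (k + 1) → ℝ), p ∈ HistBox γ₁ k → β' k p = β k p)
    (h : ∀ (k : ℕ) (δ : ℝ), 0 < δ → ∃ γ : ℝ, 0 < γ ∧ ∀ p : Fin (k + 1) → ℝ, p ∈ HistBox γ k → |β' k p - b k| ≤ δ) :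
    ∀ (k : ℕ) (δ : ℝ), 0 < δ → ∃ γ : ℝ, 0 < γ ∧ ∀ p : Fin (k + 1) → ℝ, p ∈ HistBox γ k → |β k p - b k| ≤ δ := by
  intro k δ hδ
  obtain ⟨γ, hγ, hb⟩ := h k δ hδ
  refine ⟨min γ γ₁, lt_min hγ hγ₁, fun p hp => ?_⟩
  have hpγ : p ∈ HistBox γ k := fun i => ⟨(hp i).1, (hp i).2.trans (min_le_left _ _)⟩
  have hpγ₁ : p ∈ HistBox γ₁ k := fun i => ⟨(hp i).1, (hp i).2.trans (min_le_right _ _)⟩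
  rw [← hagree k p hpγ₁]
  exact hb p hpγ

/-- **★ Two β's agreeing on a box, each with a split whose remainder vanishes scale by scale near the zero history, have the SAME zero-history values** (hence the same
one-loop numbers in every split). [folklore] -/
theorem apply_zero_eq_of_anchorVanishing_of_eqOn (S : OneLoopSplit β) (S' : OneLoopSplit β') {γ₁ : ℝ} (hγ₁ : 0 < γ₁)
    (hagree : ∀ (k : ℕ) (p : Fin (k + 1) → ℝ), p ∈ HistBox γ₁ k → β' k p = β k p)
    (h : ∀ k : ℕ, ∀ δ : ℝ, 0 < δ → ∃ γ : ℝ, 0 < γ ∧ ∀ v ∈ Box γ k, |S.β1 k v| ≤ δ)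
    (h' : ∀ k : ℕ, ∀ δ : ℝ, 0 < δ → ∃ γ : ℝ, 0 < γ ∧ ∀ v ∈ Box γ k, |S'.β1 k v| ≤ δ) :
    (fun k => β k (fun _ => 0)) = fun k => β' k (fun _ => 0) :=
  eq_of_anchors (anchorAtZero_of_anchorVanishing S h) (anchor_congr_of_eqOn hγ₁ hagree (anchorAtZero_of_anchorVanishing S' h'))

end Generic

/-! ## §2 At NODE 00's Stage-13 record (`N = 2`, v1.7 `H` Sep-Co-PH provisos): the kill at the stub's text, modulo the inline hypothesis «two base histories» -/

section Kill

/-- The β of record AT THE ZERO HISTORY is the record's one-loop number `beta0OfMerged … θ.v₀ k` (box convention: the zero history is off the box) — so the hypothesis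
below reads without the merged term. [cite: Balaban1987RG1, (1.22) p.264 and (2.12)–(2.14) p.268 (bookkeeping)] -/
theorem βfun_apply_zero (F : T4Family) (θ : Node00.Stage13HParams F 2) (hP : θ.Provisos₁₃SepCoPH F 2) (k : ℕ) :
    letI := θ.instVβ₁; letI := θ.instVβ₂; letI := θ.instιβ
    (Node00.datumOfRecord₁₃SepCoPH F 2 θ hP).βfun k (fun _ => 0) =
      beta0OfMerged (betaMerged F (mergedTermFamilyMatT F 2 (TcanOfRecord F 2) (chiFixed29 F 2 θ.ν θ.ε₂₉) θ.εbg) θ.ρ8 θ.bV) θ.v₀ k :=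
  betaOfMerged_of_notMem _ _ _ fun hmem => lt_irrefl (0 : ℝ) ((mem_box.mp hmem) (Fin.last k)).1

/-- **★ `stub_anchor13 : D4AnchorRecord13` (v3 :417, `AnchorVanishing` :233 unfolded — text VERBATIM otherwise) IS FALSE MODULO TWO BASE HISTORIES.**  Hypothesis: in some
family two proviso-carrying admissible Stage-13 tuples whose β-functions of record agree on a common box `]0,γ₁]` and differ at the zero history at some scale — what two
base histories `v₀` with different last-coupling `limUnder`s of one merged β produce (`βfun_apply_zero`; `v₀` is read by no admissibility clause and no proviso).
[cite: Balaban1987RG1, (2.12)–(2.14) p.268 and (1.22) p.264 (bookkeeping)] -/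
theorem anchor13_false_of_twoBaseHistories
    (H : ∃ (F : T4Family) (θ θ' : Node00.Stage13HParams F 2) (hP : θ.Provisos₁₃SepCoPH F 2) (hP' : θ'.Provisos₁₃SepCoPH F 2),
      θ.Admissible F 2 ∧ θ'.Admissible F 2 ∧ ∃ γ₁ : ℝ, 0 < γ₁ ∧
        (∀ (k : ℕ) (p : Fin (k + 1) → ℝ), p ∈ HistBox γ₁ k →
          (Node00.datumOfRecord₁₃SepCoPH F 2 θ' hP').βfun k p = (Node00.datumOfRecord₁₃SepCoPH F 2 θ hP).βfun k p) ∧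
        ∃ k : ℕ, (Node00.datumOfRecord₁₃SepCoPH F 2 θ hP).βfun k (fun _ => 0) ≠ (Node00.datumOfRecord₁₃SepCoPH F 2 θ' hP').βfun k (fun _ => 0)) :
    ¬ (∀ (F : T4Family) (θ : Node00.Stage13HParams F 2) (hP : θ.Provisos₁₃SepCoPH F 2), θ.Admissible F 2 →
        letI := θ.instVβ₁; letI := θ.instVβ₂; letI := θ.instιβ
        ∀ k : ℕ, ∀ δ : ℝ, 0 < δ → ∃ γ : ℝ, 0 < γ ∧ ∀ v ∈ Box γ k,
          |(oneLoopSplit_betaOfMerged (betaMerged F (mergedTermFamilyMatT F 2 (TcanOfRecord F 2) (chiFixed29 F 2 θ.ν θ.ε₂₉) θ.εbg) θ.ρ8 θ.bV)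
              (beta0OfMerged (betaMerged F (mergedTermFamilyMatT F 2 (TcanOfRecord F 2) (chiFixed29 F 2 θ.ν θ.ε₂₉) θ.εbg) θ.ρ8 θ.bV) θ.v₀) θ.γ).β1 k v| ≤ δ) := by
  intro hA
  obtain ⟨F, θ, θ', hP, hP', hθ, hθ', γ₁, hγ₁, hagree, k, hne⟩ := H
  have e := apply_zero_eq_of_anchorVanishing_of_eqOn
    (β := (Node00.datumOfRecord₁₃SepCoPH F 2 θ hP).βfun) (β' := (Node00.datumOfRecord₁₃SepCoPH F 2 θ' hP').βfun)
    (oneLoopSplit_betaOfMerged _ _ _) (oneLoopSplit_betaOfMerged _ _ _) hγ₁ hagree (hA F θ hP hθ) (hA F θ' hP' hθ')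
  exact hne (congrFun e k)

/-- **The same hypothesis read on the one-loop numbers**: «agree on a box, different `beta0OfMerged … θ.v₀ k` at some scale» (`βfun_apply_zero`). [cite: Balaban1987RG1, (2.12)–(2.14) p.268 (bookkeeping)] -/
theorem anchor13_false_of_twoBaseHistories'
    (H : ∃ (F : T4Family) (θ θ' : Node00.Stage13HParams F 2) (hP : θ.Provisos₁₃SepCoPH F 2) (hP' : θ'.Provisos₁₃SepCoPH F 2),
      θ.Admissible F 2 ∧ θ'.Admissible F 2 ∧ ∃ γ₁ : ℝ, 0 < γ₁ ∧
        (∀ (k : ℕ) (p : Fin (k + 1) → ℝ), p ∈ HistBox γ₁ k →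
          (Node00.datumOfRecord₁₃SepCoPH F 2 θ' hP').βfun k p = (Node00.datumOfRecord₁₃SepCoPH F 2 θ hP).βfun k p) ∧
        ∃ k : ℕ,
          (letI := θ.instVβ₁; letI := θ.instVβ₂; letI := θ.instιβ
           beta0OfMerged (betaMerged F (mergedTermFamilyMatT F 2 (TcanOfRecord F 2) (chiFixed29 F 2 θ.ν θ.ε₂₉) θ.εbg) θ.ρ8 θ.bV) θ.v₀ k) ≠
          (letI := θ'.instVβ₁; letI := θ'.instVβ₂; letI := θ'.instιβ
           beta0OfMerged (betaMerged F (mergedTermFamilyMatT F 2 (TcanOfRecord F 2) (chiFixed29 F 2 θ'.ν θ'.ε₂₉) θ'.εbg) θ'.ρ8 θ'.bV) θ'.v₀ k)) :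
    ¬ (∀ (F : T4Family) (θ : Node00.Stage13HParams F 2) (hP : θ.Provisos₁₃SepCoPH F 2), θ.Admissible F 2 →
        letI := θ.instVβ₁; letI := θ.instVβ₂; letI := θ.instιβ
        ∀ k : ℕ, ∀ δ : ℝ, 0 < δ → ∃ γ : ℝ, 0 < γ ∧ ∀ v ∈ Box γ k,
          |(oneLoopSplit_betaOfMerged (betaMerged F (mergedTermFamilyMatT F 2 (TcanOfRecord F 2) (chiFixed29 F 2 θ.ν θ.ε₂₉) θ.εbg) θ.ρ8 θ.bV)
              (beta0OfMerged (betaMerged F (mergedTermFamilyMatT F 2 (TcanOfRecord F 2) (chiFixed29 F 2 θ.ν θ.ε₂₉) θ.εbg) θ.ρ8 θ.bV) θ.v₀) θ.γ).β1 k v| ≤ δ) := by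
  obtain ⟨F, θ, θ', hP, hP', hθ, hθ', γ₁, hγ₁, hagree, k, hne⟩ := H
  refine anchor13_false_of_twoBaseHistories ⟨F, θ, θ', hP, hP', hθ, hθ', γ₁, hγ₁, hagree, k, ?_⟩
  rwa [βfun_apply_zero, βfun_apply_zero]

/-- **The generic per-record kill**: ANY stub giving, at every proviso-carrying admissible Stage-13 tuple, a per-scale anchor of the β of record at its zero-history values
(= at the record's one-loop numbers, `βfun_apply_zero`) is false modulo two base histories. [cite: Balaban1987RG1, (2.12)–(2.14) p.268 (bookkeeping)] -/
theorem anchorAtZero13_false_of_twoBaseHistories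
    (H : ∃ (F : T4Family) (θ θ' : Node00.Stage13HParams F 2) (hP : θ.Provisos₁₃SepCoPH F 2) (hP' : θ'.Provisos₁₃SepCoPH F 2),
      θ.Admissible F 2 ∧ θ'.Admissible F 2 ∧ ∃ γ₁ : ℝ, 0 < γ₁ ∧
        (∀ (k : ℕ) (p : Fin (k + 1) → ℝ), p ∈ HistBox γ₁ k →
          (Node00.datumOfRecord₁₃SepCoPH F 2 θ' hP').βfun k p = (Node00.datumOfRecord₁₃SepCoPH F 2 θ hP).βfun k p) ∧
        ∃ k : ℕ, (Node00.datumOfRecord₁₃SepCoPH F 2 θ hP).βfun k (fun _ => 0) ≠ (Node00.datumOfRecord₁₃SepCoPH F 2 θ' hP').βfun k (fun _ => 0)) :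
    ¬ (∀ (F : T4Family) (θ : Node00.Stage13HParams F 2) (hP : θ.Provisos₁₃SepCoPH F 2), θ.Admissible F 2 →
        ∀ (k : ℕ) (δ : ℝ), 0 < δ → ∃ γ : ℝ, 0 < γ ∧ ∀ p : Fin (k + 1) → ℝ, p ∈ HistBox γ k →
          |(Node00.datumOfRecord₁₃SepCoPH F 2 θ hP).βfun k p - (Node00.datumOfRecord₁₃SepCoPH F 2 θ hP).βfun k (fun _ => 0)| ≤ δ) := by
  intro hA
  obtain ⟨F, θ, θ', hP, hP', hθ, hθ', γ₁, hγ₁, hagree, k, hne⟩ := H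
  have e := eq_of_anchors (hA F θ hP hθ) (anchor_congr_of_eqOn hγ₁ hagree (hA F θ' hP' hθ'))
  exact hne (congrFun e k)

/-- **idea-5's currency as typed by its g0 sketch (`Cruxes/EndpointGivenBR13SepCoPH/ConvexFibreWittenSketch.lean` :97 `AF1AtRecord13`, text VERBATIM) — (AF-1) relative to the
record's DEFINITIONAL split — is false modulo two base histories as well** (a linear box remainder anchors β at the split's numbers = β's zero-history values; an4
`anchor_of_boxRemainder`).  Re-keyed to NAMED numbers (`BoxRemainder (datum).βfun (beta0OfJs F κ) C γ₀`, skeleton v3's stub 2′ conjunct) it is not exposed.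
[cite: Balaban1987RG1, (2.13) p.268 and (1.22) p.264 (bookkeeping)] -/
theorem af1AtRecord13_false_of_twoBaseHistories
    (H : ∃ (F : T4Family) (θ θ' : Node00.Stage13HParams F 2) (hP : θ.Provisos₁₃SepCoPH F 2) (hP' : θ'.Provisos₁₃SepCoPH F 2),
      θ.Admissible F 2 ∧ θ'.Admissible F 2 ∧ ∃ γ₁ : ℝ, 0 < γ₁ ∧
        (∀ (k : ℕ) (p : Fin (k + 1) → ℝ), p ∈ HistBox γ₁ k →
          (Node00.datumOfRecord₁₃SepCoPH F 2 θ' hP').βfun k p = (Node00.datumOfRecord₁₃SepCoPH F 2 θ hP).βfun k p) ∧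
        ∃ k : ℕ, (Node00.datumOfRecord₁₃SepCoPH F 2 θ hP).βfun k (fun _ => 0) ≠ (Node00.datumOfRecord₁₃SepCoPH F 2 θ' hP').βfun k (fun _ => 0)) :
    ¬ (∀ (F : T4Continuum.T4Family) (θ : Node00.Stage13HParams F 2) (_hP : θ.Provisos₁₃SepCoPH F 2), θ.Admissible F 2 →
        letI := θ.instVβ₁; letI := θ.instVβ₂; letI := θ.instιβ
        ∃ C γ₀ : ℝ, 0 ≤ C ∧ 0 < γ₀ ∧ γ₀ ≤ θ.γ ∧ ∀ k (p : Fin (k + 1) → ℝ), p ∈ B12Beta.HistBox γ₀ k →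
          |(oneLoopSplit_betaOfMerged
              (betaMerged F (mergedTermFamilyMatT F 2 (TcanOfRecord F 2) (chiFixed29 F 2 θ.ν θ.ε₂₉) θ.εbg) θ.ρ8 θ.bV)
              (beta0OfMerged (betaMerged F (mergedTermFamilyMatT F 2 (TcanOfRecord F 2) (chiFixed29 F 2 θ.ν θ.ε₂₉) θ.εbg) θ.ρ8 θ.bV) θ.v₀)
              θ.γ).β1 k p| ≤ C * p (Fin.last k)) := by
  intro hAF
  refine anchorAtZero13_false_of_twoBaseHistories H fun F θ hP hθ => ?_
  obtain ⟨C, γ₀, hC, hγ₀, -, hb⟩ := hAF F θ hP hθ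
  have hrem : BoxRemainder (Node00.datumOfRecord₁₃SepCoPH F 2 θ hP).βfun
      (fun k => (Node00.datumOfRecord₁₃SepCoPH F 2 θ hP).βfun k (fun _ => 0)) C γ₀ := by
    intro k p hp
    have h1 := hb k p hp
    rw [split_β1_eq, split_β0_eq_apply_zero] at h1
    exact h1
  exact anchor_of_boxRemainder hrem hC hγ₀

end Kill

end Summit.QuantumFields.YangMills.Theorems.EndpointGivenBR13SepCoPH.Negative.Anchor13FalseOfTwoBaseHistories

end
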